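import Mathlib
import HarnessLib
import Summits.HubbardSuperconductivity.HubbardSuperconductivity.Theorems.KLProgrammeKLRegimeEngineDressedAliasing

/-!
# K3 gen-8-FLOW (stmt 20437, stub (C), located item #20, cure (δ′) «LAST-STEP SWAP», response door layer A): THE DRESSED ALIASING LEMMA AS A
# DIFFERENCE — `‖Dʲ[evalM (symInterp L Re(g∘p·H)) − (Re g·P₁ − Im g·P₂)](q)‖ ≤ 4·M_j(H)·3ʲ·D_g·(2/N)^{M−j−4}·4C₂ + L^{j+2}·‖g‖_∞·M_s(H)/(1+L/4)ˢ` at EVERY `q`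

Cell gate-hubbard-kl, seat p2 g17.  Layer 3 of the (B) sup route (`…EngineDressedAliasing.norm_iteratedFDeriv_evalM_symInterp_dressed_le`, p2 g14) bounds the
interpolant's jets of the dressed data `k ↦ Re(g(p_k)·H(k))` at a point `q` where the smooth factor `g` VANISHES to all orders (pure aliasing); its
successors 3′/3″ keep the main term as the FULL Fréchet jet `‖Dʲ(Re g·P)(q)‖`.  The last-step response door (memo HOME/p2-g17/LAST-THERMAL-SIZING-p2g17.md §3,
KL STATUS 2026-08-28) cannot use either: its dressing factor does not vanish at the reading point, and its Fréchet jets there grow like `ω₀⁻¹` in the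
direction NORMAL to the old Fermi curve while only the TANGENTIAL jets are small.  This file therefore keeps the main term EXACT, as a FUNCTION:

  `E(q) := Re g(q)·P₁(q) − Im g(q)·P₂(q)`,  `P₁ = Σ_{x near} Re 𝔉⁻¹H(x)·h_x`, `P₂ = Σ_{x near} Im 𝔉⁻¹H(x)·h_x`  (near: `4|x̃ᵢ| ≤ L`),

and bounds the `j`-th Fréchet derivative of the DIFFERENCE `evalM (symInterp L Re(g∘p·H)) − E` at every `q` by the same aliasing + far terms as layer 3 —
the consumer composes `E` with its curve and differentiates tangentially.  Ingredients: p2 g6's difference form of the aliasing bound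
(`norm_iteratedFDeriv_evalM_symInterp_sub_cosSeries_le`) in c4a-1's symbol / product currency (§1–§2, twins of `…C4aSymbolCosSeries` §5 and
`…C4aAliasingJetLemma` §3 with the main term moved to the left), then layer 2's harmonics split and the far part verbatim (§3).

* §1 `norm_iteratedFDeriv_evalM_symInterp_sub_symbol_le` — `‖Dʲ[I_L(F∘p)](q) − DʲF(q)‖ ≤ 2·Σ'_ν[half-tail] ‖𝓕F♭(ν)‖(|ν₀|+|ν₁|)ʲ`;
* §2 `norm_iteratedFDeriv_evalM_symInterp_sub_mul_trigPoly_le` — `‖Dʲ[I_L((g·P)∘p)](q) − Dʲ(g·P)(q)‖ ≤ 2·M_j(P̌)·G_j`;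
* §3 **`norm_iteratedFDeriv_evalM_symInterp_dressed_sub_le`** — the statement of the title.

Pure harmonic analysis; no definitions; nothing about the Hubbard model is asserted; nothing asserts superconductivity.
References: BGM 2006 §2.3 (2.17) [cite: BenfattoGiulianiMastropietro2006]; Boyd 2001 §4.5 Thm 19–20 [cite: Boyd2001]; Grafakos 2014 §3.3.3 [cite: Grafakos2014].
-/

noncomputable section

namespace Summit.HubbardSuperconductivity.HubbardSuperconductivity.Theorems.EngineV8

set_option linter.dupNamespace false -- summit = problem name (single-conjunct summit), D-0017

open Real Set MeasureTheory UnitAddTorus Finset Filter Literature.MathematicalPhysics.QuantumLattice Literature.Probability.LatticeModels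
open Literature.Analysis.Fourier Literature.Analysis.FunctionSpaces
open Summit.HubbardSuperconductivity.HubbardSuperconductivity.Theorems.KLRegimeSplit
open Summit.HubbardSuperconductivity.HubbardSuperconductivity.Theorems.C4a
open scoped ComplexConjugate

variable {L : ℕ} [NeZero L]

/-! ## §1 The symbol-level aliasing bound as a difference -/

/-- **`‖Dʲ[evalM (symInterp L (F∘p))](q) − DʲF(q)‖ ≤ 2·Σ'_ν [L/2 < |ν₀| ∨ L/2 < |ν₁|] ‖𝓕F♭(ν)‖·(|ν₀|+|ν₁|)ʲ`** for a smooth `D₄`-symmetric `2π`-periodic `F`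
with `𝓕F♭` weighted-summable at order `J ≥ j` — p2 g6's `…sub_cosSeries_le` in c4a-1's symbol currency (the in-band harmonics cancel EXACTLY). -/
theorem norm_iteratedFDeriv_evalM_symInterp_sub_symbol_le {F : Momentum → ℝ}
    (hper : ∀ (j : Fin 2) (q : Momentum), F (q + EuclideanSpace.single j (2 * π)) = F q) (hF : ContDiff ℝ (⊤ : ℕ∞) F)
    (hrefl : ∀ p : Fin 2 → ℝ, F (WithLp.toLp 2 ![p 0, -p 1]) = F (WithLp.toLp 2 p))
    (hswap : ∀ p : Fin 2 → ℝ, F (WithLp.toLp 2 ![p 1, p 0]) = F (WithLp.toLp 2 p)) {J : ℕ}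
    (hw : Summable fun ν : Fin 2 → ℤ => ‖mFourierCoeff (symbolFlat F hper) ν‖ * (1 + ∑ i, |(ν i : ℝ)|) ^ J)
    {j : ℕ} (hj : j ≤ J) (q : Momentum) :
    ‖iteratedFDeriv ℝ j (evalM (symInterp L (fun k : TorusSite 2 L => F (WithLp.toLp 2 (latticeMomentum L k))))) q -
        iteratedFDeriv ℝ j F q‖ ≤
      2 * ∑' ν : Fin 2 → ℤ, (if (L / 2 < (ν 0).natAbs ∨ L / 2 < (ν 1).natAbs) then
          ‖mFourierCoeff (symbolFlat F hper) ν‖ * (|((ν 0 : ℤ) : ℝ)| + |((ν 1 : ℤ) : ℝ)|) ^ j else 0) := by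
  have hc := summable_cosCoeffOfSymbol_weighted hper hw
  have key := norm_iteratedFDeriv_evalM_symInterp_sub_cosSeries_le (L := L) hc hj q
  have hdata : (fun k : TorusSite 2 L => cosSeries (cosCoeffOfSymbol F hper) (latticeMomentum L k)) =
      fun k : TorusSite 2 L => F (WithLp.toLp 2 (latticeMomentum L k)) :=
    funext fun k => cosSeries_cosCoeffOfSymbol hper hF hrefl hswap _
  have hsym : (fun q : Momentum => cosSeries (cosCoeffOfSymbol F hper) (WithLp.ofLp q)) = F := by
    funext q; rw [cosSeries_cosCoeffOfSymbol hper hF hrefl hswap]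
  rw [hdata, hsym] at key
  have htail := aliasTail_cosCoeffOfSymbol_le hper L hw hj
  linarith

/-! ## §2 The product-level aliasing bound as a difference -/

/-- **`‖Dʲ[evalM (symInterp L ((g·P)∘p))](q) − Dʲ(g·P)(q)‖ ≤ 2·M_j(P̌)·G_j`** — c4a-1's generic aliasing-jet lemma with the main term moved to the left:
`g` smooth `2π`-periodic, `P(q) = Σ_{x∈B} c_x cos(x·q)` resolved (`4|xᵢ| ≤ L`), `g·P` reflection/swap-symmetric, `ĝ♭` weighted-summable at order `J ≥ j`;
`M_j(P̌) = Σ_{x∈B}|c_x|(1+|x₀|+|x₁|)ʲ`, `G_j = Σ'_η [∃ i, L/4 < |ηᵢ|] ‖ĝ♭(η)‖(1+|η₀|+|η₁|)ʲ`. -/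
theorem norm_iteratedFDeriv_evalM_symInterp_sub_mul_trigPoly_le {g : Momentum → ℝ}
    (hgper : ∀ (j : Fin 2) (q : Momentum), g (q + EuclideanSpace.single j (2 * π)) = g q) (hg : ContDiff ℝ (⊤ : ℕ∞) g)
    (B : Finset (Fin 2 → ℤ)) (c : (Fin 2 → ℤ) → ℝ) (hB : ∀ x ∈ B, ∀ i, 4 * |x i| ≤ (L : ℤ))
    {P : Momentum → ℝ} (hP : ∀ q : Momentum, P q = ∑ x ∈ B, c x * Real.cos (∑ i : Fin 2, (x i : ℝ) * q i))
    (hrefl : ∀ p : Fin 2 → ℝ, (fun q => g q * P q) (WithLp.toLp 2 ![p 0, -p 1]) = (fun q => g q * P q) (WithLp.toLp 2 p))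
    (hswap : ∀ p : Fin 2 → ℝ, (fun q => g q * P q) (WithLp.toLp 2 ![p 1, p 0]) = (fun q => g q * P q) (WithLp.toLp 2 p))
    {J : ℕ} (hwg : Summable fun η : Fin 2 → ℤ => ‖mFourierCoeff (symbolFlat g hgper) η‖ * (1 + ∑ i : Fin 2, |((η i : ℤ) : ℝ)|) ^ J)
    {j : ℕ} (hj : j ≤ J) (q : Momentum) :
    ‖iteratedFDeriv ℝ j (evalM (symInterp L (fun k : TorusSite 2 L => (fun q => g q * P q) (WithLp.toLp 2 (latticeMomentum L k))))) q -
        iteratedFDeriv ℝ j (fun q => g q * P q) q‖ ≤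
      2 * ((∑ x ∈ B, |c x| * (1 + |((x 0 : ℤ) : ℝ)| + |((x 1 : ℤ) : ℝ)|) ^ j) *
        ∑' η : Fin 2 → ℤ, (if ∃ i, L / 4 < (η i).natAbs then
          ‖mFourierCoeff (symbolFlat g hgper) η‖ * (1 + ∑ i : Fin 2, |((η i : ℤ) : ℝ)|) ^ j else 0)) := by
  have hP' : ContDiff ℝ (⊤ : ℕ∞) P := by
    have hfun : P = fun q : Momentum => ∑ x ∈ B, c x * Real.cos (∑ i : Fin 2, (x i : ℝ) * q i) := funext hP
    rw [hfun]
    refine ContDiff.sum fun x _ => contDiff_const.mul (Real.contDiff_cos.comp (ContDiff.sum fun i _ => contDiff_const.mul ?_))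
    exact (EuclideanSpace.proj (𝕜 := ℝ) i).contDiff
  have hF : ContDiff ℝ (⊤ : ℕ∞) (fun q => g q * P q) := hg.mul hP'
  have hwF := summable_weighted_symbolFlat_mul_trigPoly hgper hg B c hP J hwg
  have h1 := norm_iteratedFDeriv_evalM_symInterp_sub_symbol_le (L := L) (mul_trigPoly_periodic hgper B c hP) hF hrefl hswap hwF hj q
  have hwgj : Summable fun η : Fin 2 → ℤ => ‖mFourierCoeff (symbolFlat g hgper) η‖ * (1 + ∑ i : Fin 2, |((η i : ℤ) : ℝ)|) ^ j := by
    refine Summable.of_nonneg_of_le (fun η => by positivity) (fun η => mul_le_mul_of_nonneg_left ?_ (norm_nonneg _)) hwg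
    exact pow_le_pow_right₀ (le_add_of_nonneg_right (Finset.sum_nonneg fun i _ => abs_nonneg _)) hj
  have h2 := ztail_symbolFlat_mul_trigPoly_le hgper hg B c hB hP j hwgj
  linarith

/-! ## §3 The dressed aliasing lemma as a difference -/

/-- **THE DRESSED ALIASING LEMMA AS A DIFFERENCE.**  `g : Momentum → ℂ` smooth, `2π`-periodic in each coordinate, reflection- and swap-symmetric, with
`‖D^M g‖ ≤ D_g` everywhere (`4 + j ≤ M`) and `‖g‖ ≤ A₀`; `H` ANY lattice factor with position moments `Σ_x (1+|x̃₀|+|x̃₁|)ʲ‖𝔉⁻¹H(x)‖ ≤ M_j`,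
`Σ_x (1+|x̃₀|+|x̃₁|)ˢ‖𝔉⁻¹H(x)‖ ≤ M_s`.  With the near polynomials `P₁ = Σ_{x near} Re 𝔉⁻¹H(x)·h_x`, `P₂ = Σ_{x near} Im 𝔉⁻¹H(x)·h_x` (near: `4|x̃ᵢ| ≤ L`) and the
EXACT main term `E(q) = Re g(q)·P₁(q) − Im g(q)·P₂(q)`, at EVERY continuum momentum `q`:
`‖Dʲ[evalM (symInterp L Re(g∘p·H))](q) − DʲE(q)‖ ≤ 2·(2·M_j·(3ʲ·D_g·(2/N)^{M−j−4}·(4·C₂))) + L²·Lʲ·(A₀·M_s/(1+L/4)ˢ)`, `N = 2(L/4+1)`,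
`C₂ = Σ'_{k∈ℤ²} Πᵢ(1+kᵢ²)⁻¹`. -/
theorem norm_iteratedFDeriv_evalM_symInterp_dressed_sub_le {g : Momentum → ℂ}
    (hgper : ∀ (i : Fin 2) (q : Momentum), g (q + EuclideanSpace.single i (2 * π)) = g q) (hg : ContDiff ℝ (⊤ : ℕ∞) g)
    (hrefl : ∀ p : Fin 2 → ℝ, g (WithLp.toLp 2 ![p 0, -p 1]) = g (WithLp.toLp 2 p))
    (hswap : ∀ p : Fin 2 → ℝ, g (WithLp.toLp 2 ![p 1, p 0]) = g (WithLp.toLp 2 p))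
    (H : TorusSite 2 L → ℂ) {j M : ℕ} (hM : 4 + j ≤ M) {Dg : ℝ} (hDg : ∀ q, ‖iteratedFDeriv ℝ M g q‖ ≤ Dg) {A₀ : ℝ} (hA₀ : ∀ q, ‖g q‖ ≤ A₀)
    {Mj : ℝ} (hMj : ∑ x : TorusSite 2 L, (1 + ((x 0).valMinAbs.natAbs : ℝ) + ((x 1).valMinAbs.natAbs : ℝ)) ^ j * ‖torusFourierInv H x‖ ≤ Mj)
    {s : ℕ} {Ms : ℝ} (hMs : ∑ x : TorusSite 2 L, (1 + ((x 0).valMinAbs.natAbs : ℝ) + ((x 1).valMinAbs.natAbs : ℝ)) ^ s * ‖torusFourierInv H x‖ ≤ Ms)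
    (q : Momentum) :
    ‖iteratedFDeriv ℝ j (evalM (symInterp L (fun k : TorusSite 2 L => (g (WithLp.toLp 2 (latticeMomentum L k)) * H k).re))) q -
        iteratedFDeriv ℝ j (fun q : Momentum =>
          (g q).re * (∑ x ∈ univ.filter (fun x : TorusSite 2 L => ∀ i, 4 * |(x i).valMinAbs| ≤ (L : ℤ)),
              (torusFourierInv H x).re * TrigPolyC4v.harmonic (x 0).valMinAbs.natAbs (x 1).valMinAbs.natAbs (WithLp.ofLp q)) -
            (g q).im * (∑ x ∈ univ.filter (fun x : TorusSite 2 L => ∀ i, 4 * |(x i).valMinAbs| ≤ (L : ℤ)),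
              (torusFourierInv H x).im * TrigPolyC4v.harmonic (x 0).valMinAbs.natAbs (x 1).valMinAbs.natAbs (WithLp.ofLp q))) q‖ ≤
      2 * (2 * (Mj * ((3 : ℝ) ^ j * Dg * (2 / ((2 * (L / 4 + 1) : ℕ) : ℝ)) ^ (M - j - 4) *
        (2 ^ 2 * ∑' k : Fin 2 → ℤ, ∏ i, (1 + (k i : ℝ) ^ 2)⁻¹)))) +
        (L : ℝ) ^ 2 * (L : ℝ) ^ j * (A₀ * (Ms / (1 + (L : ℝ) / 4) ^ s)) := by
  classical
  -- names
  set G : TorusSite 2 L → ℂ := fun k => g (WithLp.toLp 2 (latticeMomentum L k)) with hG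
  set near : Finset (TorusSite 2 L) := univ.filter (fun x : TorusSite 2 L => ∀ i, 4 * |(x i).valMinAbs| ≤ (L : ℤ)) with hnear
  set far : Finset (TorusSite 2 L) := univ.filter (fun x : TorusSite 2 L => ¬ ∀ i, 4 * |(x i).valMinAbs| ≤ (L : ℤ)) with hfar
  set gre : Momentum → ℝ := fun q => (g q).re with hgre
  set gim : Momentum → ℝ := fun q => (g q).im with hgim
  set P₁ : Momentum → ℝ := fun q => ∑ x ∈ near, (torusFourierInv H x).re * TrigPolyC4v.harmonic (x 0).valMinAbs.natAbs (x 1).valMinAbs.natAbs (WithLp.ofLp q)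
    with hP₁
  set P₂ : Momentum → ℝ := fun q => ∑ x ∈ near, (torusFourierInv H x).im * TrigPolyC4v.harmonic (x 0).valMinAbs.natAbs (x 1).valMinAbs.natAbs (WithLp.ofLp q)
    with hP₂
  set ffar : TorusSite 2 L → ℝ := fun k => ∑ x ∈ far, (G k * torusFourierInv H x).re *
    TrigPolyC4v.harmonic (x 0).valMinAbs.natAbs (x 1).valMinAbs.natAbs (latticeMomentum L k) with hffar
  -- the exact main term is `gre·P₁ − gim·P₂`
  have hE : (fun q : Momentum =>
      (g q).re * (∑ x ∈ univ.filter (fun x : TorusSite 2 L => ∀ i, 4 * |(x i).valMinAbs| ≤ (L : ℤ)),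
          (torusFourierInv H x).re * TrigPolyC4v.harmonic (x 0).valMinAbs.natAbs (x 1).valMinAbs.natAbs (WithLp.ofLp q)) -
        (g q).im * (∑ x ∈ univ.filter (fun x : TorusSite 2 L => ∀ i, 4 * |(x i).valMinAbs| ≤ (L : ℤ)),
          (torusFourierInv H x).im * TrigPolyC4v.harmonic (x 0).valMinAbs.natAbs (x 1).valMinAbs.natAbs (WithLp.ofLp q))) =
      (fun q => gre q * P₁ q) - (fun q => gim q * P₂ q) := by
    funext q; simp only [Pi.sub_apply, hgre, hgim, hP₁, hP₂, hnear]
  -- `G` is `B₂`-invariant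
  have hGn : ∀ k, G (-k) = G k := fun k => sample_comp_neg hgper hrefl hswap k
  have hGr : ∀ k, G ![k 0, -k 1] = G k := fun k => sample_comp_reflect hgper hrefl k
  have hGs : ∀ k, G ![k 1, k 0] = G k := fun k => sample_comp_swap (L := L) hswap k
  -- the data split under the interpolant
  have hsplit : ∀ k : TorusSite 2 L, (∑ x : TorusSite 2 L, (G k * torusFourierInv H x).re *
      TrigPolyC4v.harmonic (x 0).valMinAbs.natAbs (x 1).valMinAbs.natAbs (latticeMomentum L k)) =
      ((fun q => gre q * P₁ q) (WithLp.toLp 2 (latticeMomentum L k)) - (fun q => gim q * P₂ q) (WithLp.toLp 2 (latticeMomentum L k))) + ffar k := by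
    intro k
    rw [← sum_filter_add_sum_filter_not univ (fun x : TorusSite 2 L => ∀ i, 4 * |(x i).valMinAbs| ≤ (L : ℤ))]
    simp only [hgre, hgim, hP₁, hP₂, hffar, hG, mul_sum, ← sum_sub_distrib]
    congr 1
    refine sum_congr rfl fun x _ => ?_
    rw [Complex.mul_re]
    ring
  have hfun : evalM (symInterp L (fun k : TorusSite 2 L => (g (WithLp.toLp 2 (latticeMomentum L k)) * H k).re)) = fun q' =>
      (evalM (symInterp L (fun k => (fun q => gre q * P₁ q) (WithLp.toLp 2 (latticeMomentum L k)))) q' -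
        evalM (symInterp L (fun k => (fun q => gim q * P₂ q) (WithLp.toLp 2 (latticeMomentum L k)))) q') +
        evalM (symInterp L ffar) q' := by
    funext q'
    rw [evalM_apply, eval_symInterp_dressed_eq_harmonics G H hGn hGr hGs]
    simp_rw [hsplit]
    rw [eval_symInterp_add L _ ffar, eval_symInterp_sub L]
    rfl
  -- smoothness
  have hN : ((j : ℕ∞) : WithTop ℕ∞) ≤ ((⊤ : ℕ∞) : WithTop ℕ∞) := by exact_mod_cast le_top
  have hgre_sm : ContDiff ℝ (⊤ : ℕ∞) gre := Complex.reCLM.contDiff.comp hg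
  have hgim_sm : ContDiff ℝ (⊤ : ℕ∞) gim := Complex.imCLM.contDiff.comp hg
  obtain ⟨B₁, c₁, hB₁, hP₁', hM₁⟩ := exists_trigPoly_of_near_harmonics (L := L) (fun x => (torusFourierInv H x).re)
  obtain ⟨B₂, c₂, hB₂, hP₂', hM₂⟩ := exists_trigPoly_of_near_harmonics (L := L) (fun x => (torusFourierInv H x).im)
  have hP₁q : ∀ q : Momentum, P₁ q = ∑ y ∈ B₁, c₁ y * Real.cos (∑ i : Fin 2, (y i : ℝ) * q i) := fun q => hP₁' (WithLp.ofLp q)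
  have hP₂q : ∀ q : Momentum, P₂ q = ∑ y ∈ B₂, c₂ y * Real.cos (∑ i : Fin 2, (y i : ℝ) * q i) := fun q => hP₂' (WithLp.ofLp q)
  have hcospw : ∀ y : Fin 2 → ℤ, ContDiff ℝ (⊤ : ℕ∞) (fun q : Momentum => Real.cos (∑ i : Fin 2, (y i : ℝ) * q i)) := fun y =>
    Real.contDiff_cos.comp (ContDiff.sum fun i _ => contDiff_const.mul (EuclideanSpace.proj (𝕜 := ℝ) i).contDiff)
  have hP₁sm : ContDiff ℝ (⊤ : ℕ∞) P₁ := by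
    rw [show P₁ = fun q : Momentum => ∑ y ∈ B₁, c₁ y * Real.cos (∑ i : Fin 2, (y i : ℝ) * q i) from funext hP₁q]
    exact ContDiff.sum fun y _ => contDiff_const.mul (hcospw y)
  have hP₂sm : ContDiff ℝ (⊤ : ℕ∞) P₂ := by
    rw [show P₂ = fun q : Momentum => ∑ y ∈ B₂, c₂ y * Real.cos (∑ i : Fin 2, (y i : ℝ) * q i) from funext hP₂q]
    exact ContDiff.sum fun y _ => contDiff_const.mul (hcospw y)
  have hE₁ : ContDiff ℝ j (fun q => gre q * P₁ q) := (hgre_sm.mul hP₁sm).of_le hN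
  have hE₂ : ContDiff ℝ j (fun q => gim q * P₂ q) := (hgim_sm.mul hP₂sm).of_le hN
  have hc1 : ContDiff ℝ j (evalM (symInterp L (fun k => (fun q => gre q * P₁ q) (WithLp.toLp 2 (latticeMomentum L k))))) := contDiff_evalM _
  have hc2 : ContDiff ℝ j (evalM (symInterp L (fun k => (fun q => gim q * P₂ q) (WithLp.toLp 2 (latticeMomentum L k))))) := contDiff_evalM _
  have hc3 : ContDiff ℝ j (evalM (symInterp L ffar)) := contDiff_evalM _
  -- split the jet of the difference: (I₁ − E₁) − (I₂ − E₂) + I_far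
  have hdiff : iteratedFDeriv ℝ j (evalM (symInterp L (fun k : TorusSite 2 L => (g (WithLp.toLp 2 (latticeMomentum L k)) * H k).re))) q -
      iteratedFDeriv ℝ j ((fun q => gre q * P₁ q) - (fun q => gim q * P₂ q)) q =
      (iteratedFDeriv ℝ j (evalM (symInterp L (fun k => (fun q => gre q * P₁ q) (WithLp.toLp 2 (latticeMomentum L k))))) q -
          iteratedFDeriv ℝ j (fun q => gre q * P₁ q) q) -
        (iteratedFDeriv ℝ j (evalM (symInterp L (fun k => (fun q => gim q * P₂ q) (WithLp.toLp 2 (latticeMomentum L k))))) q -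
          iteratedFDeriv ℝ j (fun q => gim q * P₂ q) q) +
        iteratedFDeriv ℝ j (evalM (symInterp L ffar)) q := by
    rw [hfun, fun_iteratedFDeriv_add_apply (hc1.sub hc2).contDiffAt hc3.contDiffAt, fun_iteratedFDeriv_sub_apply hc1.contDiffAt hc2.contDiffAt,
      iteratedFDeriv_sub_apply hE₁.contDiffAt hE₂.contDiffAt]
    abel
  rw [hE, hdiff]
  refine (norm_add_le _ _).trans (add_le_add ((norm_sub_le _ _).trans ?_) ?_)
  · -- the two differences through §2
    have hgre_per : ∀ (i : Fin 2) (q : Momentum), gre (q + EuclideanSpace.single i (2 * π)) = gre q := fun i q => by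
      simp only [hgre, hgper]
    have hgim_per : ∀ (i : Fin 2) (q : Momentum), gim (q + EuclideanSpace.single i (2 * π)) = gim q := fun i q => by
      simp only [hgim, hgper]
    have hDre : ∀ q, ‖iteratedFDeriv ℝ M gre q‖ ≤ Dg := fun q => ((norm_iteratedFDeriv_re_im_le hg M q).1).trans (hDg q)
    have hDim : ∀ q, ‖iteratedFDeriv ℝ M gim q‖ ≤ Dg := fun q => ((norm_iteratedFDeriv_re_im_le hg M q).2).trans (hDg q)
    have hflat_re : ∀ (i : Fin 2) (t : UnitAddTorus (Fin 2)),
        ‖((Literature.Analysis.FunctionSpaces.Torus.partialDeriv i)^[M] (symbolFlat gre hgre_per)) t‖ ≤ (2 * π) ^ M * Dg :=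
      norm_partialDeriv_iterate_symbolFlat_le hgre_per hgre_sm hDre
    have hflat_im : ∀ (i : Fin 2) (t : UnitAddTorus (Fin 2)),
        ‖((Literature.Analysis.FunctionSpaces.Torus.partialDeriv i)^[M] (symbolFlat gim hgim_per)) t‖ ≤ (2 * π) ^ M * Dg :=
      norm_partialDeriv_iterate_symbolFlat_le hgim_per hgim_sm hDim
    have hw_re := summable_weighted_symbolFlat_of_deriv hgre_per hgre_sm hM hflat_re
    have hw_im := summable_weighted_symbolFlat_of_deriv hgim_per hgim_sm hM hflat_im
    have hG_re := quarterTail_weighted_le (L := L) hgre_per hgre_sm hM hflat_re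
    have hG_im := quarterTail_weighted_le (L := L) hgim_per hgim_sm hM hflat_im
    have hDg0 : 0 ≤ Dg := (norm_nonneg _).trans (hDg q)
    have h2π : (2 * π) ^ M * Dg / (2 * π) ^ M = Dg := by field_simp
    rw [h2π] at hG_re hG_im
    -- symmetry of the two products
    have hh : ∀ (x : TorusSite 2 L) (p : Fin 2 → ℝ),
        TrigPolyC4v.harmonic (x 0).valMinAbs.natAbs (x 1).valMinAbs.natAbs ![p 0, -p 1] =
          TrigPolyC4v.harmonic (x 0).valMinAbs.natAbs (x 1).valMinAbs.natAbs p ∧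
        TrigPolyC4v.harmonic (x 0).valMinAbs.natAbs (x 1).valMinAbs.natAbs ![p 1, p 0] =
          TrigPolyC4v.harmonic (x 0).valMinAbs.natAbs (x 1).valMinAbs.natAbs p :=
      fun x p => ⟨TrigPolyC4v.harmonic_reflect _ _ p, TrigPolyC4v.harmonic_swap _ _ p⟩
    have hrefl₁ : ∀ p : Fin 2 → ℝ, (fun q => gre q * P₁ q) (WithLp.toLp 2 ![p 0, -p 1]) = (fun q => gre q * P₁ q) (WithLp.toLp 2 p) := by
      intro p; simp only [hgre, hP₁, hrefl, (hh _ p).1]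
    have hswap₁ : ∀ p : Fin 2 → ℝ, (fun q => gre q * P₁ q) (WithLp.toLp 2 ![p 1, p 0]) = (fun q => gre q * P₁ q) (WithLp.toLp 2 p) := by
      intro p; simp only [hgre, hP₁, hswap, (hh _ p).2]
    have hrefl₂ : ∀ p : Fin 2 → ℝ, (fun q => gim q * P₂ q) (WithLp.toLp 2 ![p 0, -p 1]) = (fun q => gim q * P₂ q) (WithLp.toLp 2 p) := by
      intro p; simp only [hgim, hP₂, hrefl, (hh _ p).1]
    have hswap₂ : ∀ p : Fin 2 → ℝ, (fun q => gim q * P₂ q) (WithLp.toLp 2 ![p 1, p 0]) = (fun q => gim q * P₂ q) (WithLp.toLp 2 p) := by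
      intro p; simp only [hgim, hP₂, hswap, (hh _ p).2]
    -- §2 twice
    have h₁ := norm_iteratedFDeriv_evalM_symInterp_sub_mul_trigPoly_le hgre_per hgre_sm B₁ c₁ hB₁ hP₁q hrefl₁ hswap₁ hw_re le_rfl q
    have h₂ := norm_iteratedFDeriv_evalM_symInterp_sub_mul_trigPoly_le hgim_per hgim_sm B₂ c₂ hB₂ hP₂q hrefl₂ hswap₂ hw_im le_rfl q
    -- the moments of the aggregated coefficients
    have hwt : ∀ x : TorusSite 2 L, 0 ≤ (1 + ((x 0).valMinAbs.natAbs : ℝ) + ((x 1).valMinAbs.natAbs : ℝ)) ^ j := fun x => by positivity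
    have hMre : ∑ y ∈ B₁, |c₁ y| * (1 + |((y 0 : ℤ) : ℝ)| + |((y 1 : ℤ) : ℝ)|) ^ j ≤ Mj := by
      refine (hM₁ j).trans (le_trans ?_ hMj)
      refine (sum_le_sum_of_subset_of_nonneg (filter_subset _ _) fun x _ _ => by positivity).trans (sum_le_sum fun x _ => ?_)
      rw [mul_comm]
      exact mul_le_mul_of_nonneg_left (Complex.abs_re_le_norm _) (hwt x)
    have hMim : ∑ y ∈ B₂, |c₂ y| * (1 + |((y 0 : ℤ) : ℝ)| + |((y 1 : ℤ) : ℝ)|) ^ j ≤ Mj := by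
      refine (hM₂ j).trans (le_trans ?_ hMj)
      refine (sum_le_sum_of_subset_of_nonneg (filter_subset _ _) fun x _ _ => by positivity).trans (sum_le_sum fun x _ => ?_)
      rw [mul_comm]
      exact mul_le_mul_of_nonneg_left (Complex.abs_im_le_norm _) (hwt x)
    have hGpos : 0 ≤ (3 : ℝ) ^ j * Dg * (2 / ((2 * (L / 4 + 1) : ℕ) : ℝ)) ^ (M - j - 4) * (2 ^ 2 * ∑' k : Fin 2 → ℤ, ∏ i, (1 + (k i : ℝ) ^ 2)⁻¹) := by
      have : 0 ≤ ∑' k : Fin 2 → ℤ, ∏ i, (1 + (k i : ℝ) ^ 2)⁻¹ := tsum_nonneg fun k => prod_nonneg fun i _ => by positivity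
      positivity
    have hM1pos : 0 ≤ ∑ y ∈ B₁, |c₁ y| * (1 + |((y 0 : ℤ) : ℝ)| + |((y 1 : ℤ) : ℝ)|) ^ j := sum_nonneg fun y _ => by positivity
    have hM2pos : 0 ≤ ∑ y ∈ B₂, |c₂ y| * (1 + |((y 0 : ℤ) : ℝ)| + |((y 1 : ℤ) : ℝ)|) ^ j := sum_nonneg fun y _ => by positivity
    calc ‖iteratedFDeriv ℝ j (evalM (symInterp L fun k => (fun q => gre q * P₁ q) (WithLp.toLp 2 (latticeMomentum L k)))) q -
            iteratedFDeriv ℝ j (fun q => gre q * P₁ q) q‖ +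
          ‖iteratedFDeriv ℝ j (evalM (symInterp L fun k => (fun q => gim q * P₂ q) (WithLp.toLp 2 (latticeMomentum L k)))) q -
            iteratedFDeriv ℝ j (fun q => gim q * P₂ q) q‖
        ≤ 2 * ((∑ y ∈ B₁, |c₁ y| * (1 + |((y 0 : ℤ) : ℝ)| + |((y 1 : ℤ) : ℝ)|) ^ j) *
            ((3 : ℝ) ^ j * Dg * (2 / ((2 * (L / 4 + 1) : ℕ) : ℝ)) ^ (M - j - 4) * (2 ^ 2 * ∑' k : Fin 2 → ℤ, ∏ i, (1 + (k i : ℝ) ^ 2)⁻¹))) +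
          2 * ((∑ y ∈ B₂, |c₂ y| * (1 + |((y 0 : ℤ) : ℝ)| + |((y 1 : ℤ) : ℝ)|) ^ j) *
            ((3 : ℝ) ^ j * Dg * (2 / ((2 * (L / 4 + 1) : ℕ) : ℝ)) ^ (M - j - 4) * (2 ^ 2 * ∑' k : Fin 2 → ℤ, ∏ i, (1 + (k i : ℝ) ^ 2)⁻¹))) := by
          refine add_le_add (h₁.trans ?_) (h₂.trans ?_)
          · exact mul_le_mul_of_nonneg_left (mul_le_mul_of_nonneg_left hG_re hM1pos) (by norm_num)
          · exact mul_le_mul_of_nonneg_left (mul_le_mul_of_nonneg_left hG_im hM2pos) (by norm_num)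
      _ ≤ 2 * (2 * (Mj * ((3 : ℝ) ^ j * Dg * (2 / ((2 * (L / 4 + 1) : ℕ) : ℝ)) ^ (M - j - 4) *
            (2 ^ 2 * ∑' k : Fin 2 → ℤ, ∏ i, (1 + (k i : ℝ) ^ 2)⁻¹)))) := by
          nlinarith [mul_le_mul_of_nonneg_right hMre hGpos, mul_le_mul_of_nonneg_right hMim hGpos]
  · -- the far part, verbatim
    have hA₀' : ∀ k : TorusSite 2 L, ‖G k‖ ≤ A₀ := fun k => hA₀ _
    have hR : (0 : ℝ) ≤ (L : ℝ) / 4 := by positivity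
    have hT : ∑ x ∈ far, ‖torusFourierInv H x‖ ≤ Ms / (1 + (L : ℝ) / 4) ^ s := by
      have h := sum_far_momentWeight_norm_torusFourierInv_le H (j := 0) (s := s) (Nat.zero_le _) hR hMs
      simp only [pow_zero, one_mul, Nat.sub_zero] at h
      exact (sum_le_sum_of_subset_of_nonneg farSites_subset fun x _ _ => norm_nonneg _).trans h
    exact norm_iteratedFDeriv_evalM_symInterp_farHarmonics_le G hA₀' (torusFourierInv H) far hT j q

end Summit.HubbardSuperconductivity.HubbardSuperconductivity.Theorems.EngineV8

end
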